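import Summits.BirchSwinnertonDyer.BirchSwinnertonDyer.Theorems.PrintCf2RamifiedOffTYZLevelTwoHalves
import Summits.BirchSwinnertonDyer.Rank1Residual.P2.CongruentNumberSilentEvenFiveThetaGaloisBookkeeping
import HarnessLib

/-!
# Route `PrintCf2`, crux stmt-BirchSwinnertonDyer-20509 `RamifiedOffTYZOfFacts` — THE GENUS-QUOTIENT COCYCLE OF `P(n)` IS
# TORSION-VALUED ON ALL OF `Gal(ℍ′_n/K_n)`, AND THE UPPER-HALF DOOR FOR EVERY ELEMENT FIXING `√−n` (`i`-flipping ones included)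
# (cell `bsd-print-cf2`, LEAD of 20509 g11, line `offtyz-v7`, lineage cycle 12, sequel of `…LevelTwoHalves`; fact-free, Theses-free, no `def`)

HONEST FRAMING (crux 20509 = `𝔅_ram → WAllCornerFTwoRamifiedOffTYZProved`, DECIDING, OPEN AS A CLASS): bookkeeping on
Tian–Yuan–Zhang's Theorem 3.5 main clause and Lemma 3.18 taken as HYPOTHESES on the displayed data (`D.thm35Main`,
`D.scriptLSpec`, `D.lemma318` on `D : GenusPointData n`, arXiv:1411.4728 §3 AS PRINTED), GZK by name, the W2 descent kernel
(`stub_S0`, `twist_halving`), g3's `ρ`-free main clause (p665240), g4's Galois-motion file (p671505) and the explicit torsion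
points of bsd-monsky's `…SilentEvenFiveThetaFourTorsion` (`tPlus`, `tMinus`, `map_sub_tPlus_tMinus`).  Nothing is asserted; C⁺ =
`stub_offTYZ_levelTwoScriptLExact` (= item stmt-BirchSwinnertonDyer-23431) stays open.

* §3 `galPt_genusPoint_sub_isOfFinAddOrder` — **for EVERY `g ∈ Aut_ℚ(ℍ′_n)` fixing `√−n`, `g·P(n) − P(n)` is a torsion point**
  (square-free `n`, rank `≤ 1`, `𝓛(n) ≠ 0`; `_of_analyticRank`: on the class of C⁺ with GZK): the cocycle of the genus point on
  `Gal(ℍ′_n/K_n)` — genus-field-moving and `i`-flipping elements included — is torsion-valued (the lineage so far moved `P(n)` only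
  by `g` trivial on `L_n(i)`; `2·P(n) ≡ ±𝓛(n)·Q₁` with `φ_H(Q₁)` rational over `K_n`, so `g` fixes `2·Q₁`; apply `g`, subtract).
* §4 `galPt_sub_self_eq_zero_or_eq_tauOne_of_flip` — for ODD `n` (Lemma 3.18) an automorphism with `g(i) = −i` moves every
  torsion point of `A(ℍ′_n)` by `0` or `τ(1)` (the eight points `A[(1+i)³]`: `O, (0,0), (2,±4)` fixed, `(g−1)(±2i,0) = τ(1)`,
  `(g−1)(−2,±4i) = 2τ(i/2) = τ(1)`); hence (`galPt_sub_self_eq_zero_or_eq_tauOne`) EVERY `g` does.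
  **`not_four_dvd_of_galPt_genusPoint_sub_ne`: if some `g ∈ Aut_ℚ(ℍ′_n)` with `g(√−n) = √−n` (ANY action on `i` and on the genus
  field) has `g·P(n) − P(n) ∉ {0, τ(1)}`, then `4 ∤ L` for every `L` with `𝓛(n)² = L²`** — g4's door `not_four_dvd_of_galPt_genusPoint_ne`
  (`g(i) = i`, `g·P(n) ≠ P(n)`) extended to the `i`-flipping half of `Gal(ℍ′_n/K_n)`; contrapositive `galPt_genusPoint_sub_mem_of_four_dvd`
  (the B-locus reading: `4 ∣ 𝓛(n)` ⟹ every `g` fixing `√−n` moves `P(n)` by `0` or `τ(1)`); and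
  **`levelTwo_of_half_not_twoDivisible_of_galPt_genusPoint_sub_ne`: visibility (`[Q₁] ≠ 0`) + such a mover ⟹ the conclusion of
  C⁺ at `n`** (a door for C⁺ itself: lower half by `…LevelTwoHalves` §2, upper half by the door).

What this buys the line (LEAD census, crux 20509): every element of `Gal(ℍ′_n/K_n)` moves `P(n)` inside the eight-point torsion,
and ANY such motion outside `{0, τ(1)}` certifies the upper half `4 ∤ 𝓛(n)`; at `s = 3` (where all squares are silent, g10) the
remaining candidates are the genus involutions and the `i`-flippers fixing `√−n` (e.g. `c∘β′`), whose values are NOT fixed by the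
displayed statements (LEAD note `Lines/offtyz_v7_Certificates.md` §3).  Beyond-print theorem: NO; C⁺ stays open; BSD is not
proved by any of this; no class is closed by this file.

References: [cite: TianYuanZhang2017, Thm. 3.5 (p0011 L94–L100), Lemma 3.16 (p0017 L98–L113), Lemma 3.18 (p0017 L152–L153),
§3.1 (p0011 L27–L36), §3.2 (p0012 L1–L18)]; [cite: SilvermanAEC2009, III.4.5, X.4.9]; [cite: Darmon2004, Thm. 3.22] (GZK); tree:
`…LevelTwoHalves` (this seat), g3 `…LevelTwoHalfGenerator` (p665240), g4 `…GaloisMotion` (p671505),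
bsd-monsky `Rank1Residual/P2/…SilentEvenFiveThetaFourTorsion`, `…ThetaGaloisBookkeeping` (`apply_im_eq_or`).
-/

noncomputable section

open scoped Classical

open WeierstrassCurve WeierstrassCurve.Affine Literature.NumberTheory.EllipticCurves
  Literature.NumberTheory.EllipticCurves.Rank1Residual Summit.BirchSwinnertonDyer.Rank1Residual
  Literature.NumberTheory.EllipticCurves.TianYuanZhang2017
  Literature.NumberTheory.EllipticCurves.TianYuanZhang2017.W2
  Summit.BirchSwinnertonDyer.PrintCf2.LevelTwoHalfGenerator
  Summit.BirchSwinnertonDyer.PrintCf2.GaloisMotion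
  Summit.BirchSwinnertonDyer.Rank1Residual.P2.ThetaDescent
  Summit.BirchSwinnertonDyer.PrintCf2.LevelTwoHalves

set_option autoImplicit false

namespace Summit.BirchSwinnertonDyer.PrintCf2.LevelTwoGenusQuotient

section EnSide

variable {n : ℕ}

/-! ## §3 The genus-quotient cocycle is torsion-valued -/

/-- **Every `g ∈ Aut_ℚ(ℍ′_n)` fixing `√−n` moves `P(n)` by a TORSION point** — square-free `n` with `rank E_n(ℚ) ≤ 1` and
`𝓛(n) ≠ 0`, data with Thm 3.5's displayed main clause: `g·P(n) − P(n) ∈ A(ℍ′_n)_tor`, whether or not `g` fixes `i` or the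
genus field.  (`2·P(n) ≡ ±𝓛(n)·Q₁` with `φ_H(Q₁)` rational over `K_n`, so `g` fixes `2·Q₁`; apply `g` and subtract.)
[cite: TianYuanZhang2017, Thm. 3.5 (p0011 L94–L100), §3.1 (p0011 L27–L36), Lemma 3.16 (p0017 L105–L113)] -/
theorem galPt_genusPoint_sub_isOfFinAddOrder (hsq : Squarefree n) [(congruentNumberCurve n).IsElliptic]
    (hr1 : (congruentNumberCurve n).mordellWeilRank ≤ 1) (D : GenusPointData n) (h35 : D.thm35Main)
    (hL0 : D.scriptL n ≠ 0) (g : D.H ≃ₐ[ℚ] D.H) (hgK : g (D.sqrtNeg n) = D.sqrtNeg n) :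
    IsOfFinAddOrder (D.galPt g (D.P n) - D.P n) := by
  have hn : n ∈ n.divisors := Nat.mem_divisors_self n hsq.ne_zero
  obtain ⟨R, hR⟩ := stub_S0 (n := n) hr1
  obtain ⟨Q₁, hQ₁⟩ := twist_halving hsq hn D R
  obtain ⟨u, -, hrel⟩ := two_smul_genusPoint_sub_smul_half_isOfFinAddOrder hsq hr1 D h35 hL0 hR hQ₁
  refine isOfFinAddOrder_map_sub_of_two_smul (D.galPt g) ?_ hrel
  rw [smul_sub, sub_eq_zero, ← map_zsmul]
  exact galPt_two_smul_half_eq D hn g hgK hQ₁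

/-- **The same on the class of C⁺, with GZK supplying `rank ≤ 1` and `𝓛(n) ≠ 0`**: square-free `n ≡ 5, 6, 7 (mod 8)` of analytic
rank one, data with Thm 3.5 + integrality: every `g` with `g(√−n) = √−n` moves `P(n)` inside `A(ℍ′_n)_tor`.
[cite: TianYuanZhang2017, Thm. 3.5 (p0011 L94–L100)] [cite: Darmon2004, Thm. 3.22] -/
theorem galPt_genusPoint_sub_isOfFinAddOrder_of_analyticRank
    (hGZK : rank_eq_analyticRank_of_analyticRank_le_one) (hsq : Squarefree n)
    (h8 : n % 8 = 5 ∨ n % 8 = 6 ∨ n % 8 = 7) (hr : (congruentNumberCurve n).analyticRank = 1)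
    (D : GenusPointData n) (h35 : D.thm35Main) (hLs : D.scriptLSpec)
    (g : D.H ≃ₐ[ℚ] D.H) (hgK : g (D.sqrtNeg n) = D.sqrtNeg n) :
    IsOfFinAddOrder (D.galPt g (D.P n) - D.P n) := by
  haveI := isElliptic_congruentNumberCurve hsq.ne_zero
  have hn : n ∈ n.divisors := Nat.mem_divisors_self n hsq.ne_zero
  have hn1 : 1 < n := by rcases h8 with h | h | h <;> omega
  have hLD : IsScriptL n (D.scriptL n) := hLs n hn hn1
  have hL0 : D.scriptL n ≠ 0 := (P2.bsdp_two_congruentNumberCurve_iff_of_isScriptL hGZK hsq hr hLD).2.2.1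
  have hrank : (congruentNumberCurve n).mordellWeilRank = 1 := (hGZK _ hr.le).1.trans hr
  exact galPt_genusPoint_sub_isOfFinAddOrder hsq hrank.le D h35 hL0 g hgK

/-! ## §4 `i`-flipping automorphisms move the torsion inside `{0, τ(1)}`; the upper-half door on all of `Gal(ℍ′_n/K_n)` -/

/-- `g` fixes the rational torsion points `τ(1/2) = (2, 4)` and `τ(1) = (0, 0)`. [cite: TianYuanZhang2017, §3.2 (p0012 L1–L18)] -/
theorem galPt_tauHalf (D : GenusPointData n) (g : D.H ≃ₐ[ℚ] D.H) :
    D.galPt g tauHalf = tauHalf ∧ D.galPt g tauOne = tauOne := by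
  constructor
  · exact galPt_some_eq_of_fixed D g _ (map_ofNat g 2) (map_ofNat g 4)
  · exact galPt_some_eq_of_fixed D g _ (map_zero g) (map_zero g)

/-- `g(i) = −i` sends `τ(i/2) = (−2, 4i)` to its negative `(−2, −4i)`. [cite: TianYuanZhang2017, §3.2 (p0012 L12–L18)] -/
theorem galPt_cmI_tauHalf_of_flip (D : GenusPointData n) (g : D.H ≃ₐ[ℚ] D.H) (hgi : g D.im = -D.im) :
    D.galPt g (cmI D.im D.im_sq tauHalf) = -cmI D.im D.im_sq tauHalf := by
  obtain ⟨h1, -, h3, -, -⟩ := curveA_baseChange_a (H := D.H)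
  rw [tauHalf, cmI_some, GenusPointData.galPt, Point.map_some, Point.neg_some]
  congr 1
  · simp [map_neg, map_ofNat]
  · rw [negY, h1, h3]
    simp [map_mul, hgi, map_ofNat]

/-- **An `i`-FLIPPING automorphism moves every torsion point of `A(ℍ′_n)` by `0` or `τ(1)`** (ODD `n`, Lemma 3.18: the torsion is
the eight points `A[(1+i)³]`; `g` fixes `O, (0,0), (2,±4)`, swaps `(2i,0) ↔ (−2i,0)` (difference `τ(1)`) and `(−2,4i) ↔ (−2,−4i)`
(difference `2τ(i/2) = τ(1)`)). [cite: TianYuanZhang2017, Lemma 3.18 (p0017 L152–L153) and Lemma 3.16 (p0017 L98–L113)] -/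
theorem galPt_sub_self_eq_zero_or_eq_tauOne_of_flip (D : GenusPointData n) (hodd : Odd n) (h318 : D.lemma318)
    (g : D.H ≃ₐ[ℚ] D.H) (hgi : g D.im = -D.im) {t : APoint D.H} (ht : IsOfFinAddOrder t) :
    D.galPt g t - t = 0 ∨ D.galPt g t - t = tauOne := by
  obtain ⟨-, h2⟩ := h318.1 hodd t ht
  have hθ : Point.map (W' := curveA) (g : D.H →ₐ[ℚ] D.H) = D.galPt g := rfl
  rcases h2 with h0 | h1
  · rcases eq_of_two_nsmul_eq_zero D.im D.im_sq t h0 with rfl | rfl | rfl | rfl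
    · left; rw [map_zero, sub_zero]
    · left; rw [(galPt_tauHalf D g).2, sub_self]
    · right
      have := (map_sub_tPlus_tMinus (g : D.H →ₐ[ℚ] D.H) D.im D.im_sq hgi).1
      rwa [hθ] at this
    · right
      have := (map_sub_tPlus_tMinus (g : D.H →ₐ[ℚ] D.H) D.im D.im_sq hgi).2
      rwa [hθ] at this
  · have h2c : (2 : ℕ) • cmI D.im D.im_sq (tauHalf : APoint D.H) = tauOne := two_nsmul_cmI_tauHalf D.im D.im_sq
    have hneg1 : -(tauOne : APoint D.H) = tauOne := by
      rw [neg_eq_iff_add_eq_zero, ← two_nsmul, two_nsmul_tauOne]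
    rcases eq_of_two_nsmul_eq_tauOne D.im D.im_sq t h1 with rfl | rfl | rfl | rfl
    · left; rw [(galPt_tauHalf D g).1, sub_self]
    · left; rw [map_neg, (galPt_tauHalf D g).1, sub_self]
    · right
      rw [galPt_cmI_tauHalf_of_flip D g hgi, ← neg_add', ← two_nsmul, h2c, hneg1]
    · right
      rw [map_neg, galPt_cmI_tauHalf_of_flip D g hgi, neg_neg, sub_neg_eq_add, ← two_nsmul, h2c]

/-- For ODD `n` (Lemma 3.18), EVERY `g ∈ Aut_ℚ(ℍ′_n)` moves every torsion point by `0` or `τ(1)` (`g(i) = i`: fixed, g4's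
`galPt_eq_self_of_isOfFinAddOrder`; `g(i) = −i`: the previous lemma). [cite: TianYuanZhang2017, Lemma 3.18 (p0017 L152–L153)] -/
theorem galPt_sub_self_eq_zero_or_eq_tauOne (D : GenusPointData n) (hodd : Odd n) (h318 : D.lemma318)
    (g : D.H ≃ₐ[ℚ] D.H) {t : APoint D.H} (ht : IsOfFinAddOrder t) :
    D.galPt g t - t = 0 ∨ D.galPt g t - t = tauOne := by
  rcases apply_im_eq_or D g with hgi | hgi
  · left; rw [galPt_eq_self_of_isOfFinAddOrder D hodd h318 g hgi ht, sub_self]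
  · exact galPt_sub_self_eq_zero_or_eq_tauOne_of_flip D hodd h318 g hgi ht

/-- **THE UPPER-HALF DOOR ON ALL OF `Gal(ℍ′_n/K_n)`.**  Square-free ODD `n ≡ 5, 7 (mod 8)` with `ord_{s=1} L(E_n, s) = 1`; GZK;
data `D` with Thm 3.5's displayed main clause, integrality and Lemma 3.18.  If some `g ∈ Aut_ℚ(ℍ′_n)` with `g(√−n) = √−n` —
ANY action on `i` and on the genus field — satisfies **`g·P(n) − P(n) ∉ {0, τ(1)}`**, then `4 ∤ L` for every integer `L` with
`𝓛(n)² = L²`.  (If `4 ∣ 𝓛` then `P(n) = 2m·Q₁ + t`, and `g·P − P = m·2(gQ₁ − Q₁) + (gt − t) = gt − t ∈ {0, τ(1)}`.)  For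
`g(i) = i` this is g4's `not_four_dvd_of_galPt_genusPoint_ne` (there `gt = t`); the `i`-flipping half of `Gal(ℍ′_n/K_n)` is new.
[cite: TianYuanZhang2017, Thm. 3.5 (p0011 L94–L100), Lemma 3.18 (p0017 L152–L153)] [cite: Darmon2004, Thm. 3.22] -/
theorem not_four_dvd_of_galPt_genusPoint_sub_ne
    (hGZK : rank_eq_analyticRank_of_analyticRank_le_one) (hsq : Squarefree n)
    (h8 : n % 8 = 5 ∨ n % 8 = 7) (hr : (congruentNumberCurve n).analyticRank = 1)
    (D : GenusPointData n) (h35 : D.thm35Main) (hLs : D.scriptLSpec) (h318 : D.lemma318)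
    (g : D.H ≃ₐ[ℚ] D.H) (hgK : g (D.sqrtNeg n) = D.sqrtNeg n)
    (hmove0 : D.galPt g (D.P n) - D.P n ≠ 0) (hmove1 : D.galPt g (D.P n) - D.P n ≠ tauOne) :
    ∀ L : ℤ, IsScriptL n L → ¬ (4 : ℤ) ∣ L := by
  haveI := isElliptic_congruentNumberCurve hsq.ne_zero
  have hodd : Odd n := by rcases h8 with h | h <;> exact Nat.odd_iff.mpr (by omega)
  have h8' : n % 8 = 5 ∨ n % 8 = 6 ∨ n % 8 = 7 := by rcases h8 with h | h <;> omega
  have hn : n ∈ n.divisors := Nat.mem_divisors_self n hsq.ne_zero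
  have hrank : (congruentNumberCurve n).mordellWeilRank = 1 := (hGZK _ hr.le).1.trans hr
  obtain ⟨R, hR⟩ := stub_S0 (n := n) hrank.le
  obtain ⟨Q₁, hQ₁⟩ := twist_halving hsq hn D R
  have h4 : ¬ ∃ m : ℤ, IsOfFinAddOrder (D.P n - (2 * m) • Q₁) := by
    refine not_exists_two_mul_zsmul_of_map_sub_not_mem (D.galPt g) {x | x = 0 ∨ x = tauOne} ?_ ?_ ?_
    · rw [smul_sub, sub_eq_zero, ← map_zsmul]
      exact galPt_two_smul_half_eq D hn g hgK hQ₁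
    · intro t ht
      exact galPt_sub_self_eq_zero_or_eq_tauOne D hodd h318 g ht
    · rintro (h | h)
      · exact hmove0 h
      · exact hmove1 h
  rw [← four_dvd_scriptL_iff_genusPoint_mem_twice_line hGZK hsq h8' hr D h35 hLs hR hQ₁] at h4
  intro L hL hL4
  apply h4
  intro L' hL'
  rcases LevelTwo.eq_or_eq_neg_of_isScriptL hL' hL with rfl | rfl
  · exact hL4
  · exact (dvd_neg).mpr hL4

/-- **`4 ∣ 𝓛(n)` ⟹ every `g ∈ Gal(ℍ′_n/K_n)` moves `P(n)` by `0` or `τ(1)`** (contrapositive; the B-locus reading on the whole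
of `Gal(ℍ′_n/K_n)`, `i`-flippers included). [cite: TianYuanZhang2017, Thm. 3.5 (p0011 L94–L100), Lemma 3.18 (p0017 L152–L153)] [cite: Darmon2004, Thm. 3.22] -/
theorem galPt_genusPoint_sub_mem_of_four_dvd
    (hGZK : rank_eq_analyticRank_of_analyticRank_le_one) (hsq : Squarefree n)
    (h8 : n % 8 = 5 ∨ n % 8 = 7) (hr : (congruentNumberCurve n).analyticRank = 1)
    (D : GenusPointData n) (h35 : D.thm35Main) (hLs : D.scriptLSpec) (h318 : D.lemma318)
    {L : ℤ} (hL : IsScriptL n L) (h4 : (4 : ℤ) ∣ L)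
    (g : D.H ≃ₐ[ℚ] D.H) (hgK : g (D.sqrtNeg n) = D.sqrtNeg n) :
    D.galPt g (D.P n) - D.P n = 0 ∨ D.galPt g (D.P n) - D.P n = tauOne := by
  by_contra hne
  obtain ⟨h0, h1⟩ := not_or.mp hne
  exact not_four_dvd_of_galPt_genusPoint_sub_ne hGZK hsq h8 hr D h35 hLs h318 g hgK h0 h1 L hL h4

/-- **A DOOR FOR C⁺ AT `n`: VISIBILITY + A MOVER.**  Square-free odd `n ≡ 5, 7 (mod 8)` of analytic rank one; GZK; data with
Thm 3.5, integrality, Lemma 3.18; `R` a generator of `E_n(ℚ)` mod torsion with a half `Q₁` that is NOT `2`-divisible in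
`A(ℍ′_n)` modulo torsion (the visible part); and some `g ∈ Aut_ℚ(ℍ′_n)` fixing `√−n` with `g·P(n) − P(n) ∉ {0, τ(1)}`.  Then the
conclusion of C⁺ holds at `n`: `2 ∣ L ∧ 4 ∤ L` for every `L` with `𝓛(n)² = L²` (lower half by §2, upper half by the door).
[cite: TianYuanZhang2017, Thm. 3.5 (p0011 L94–L100), Lemma 3.18 (p0017 L152–L153)] [cite: Darmon2004, Thm. 3.22] -/
theorem levelTwo_of_half_not_twoDivisible_of_galPt_genusPoint_sub_ne
    (hGZK : rank_eq_analyticRank_of_analyticRank_le_one) (hsq : Squarefree n)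
    (h8 : n % 8 = 5 ∨ n % 8 = 7) (hr : (congruentNumberCurve n).analyticRank = 1)
    (D : GenusPointData n) (h35 : D.thm35Main) (hLs : D.scriptLSpec) (h318 : D.lemma318)
    {R : (congruentNumberCurve n).toAffine.Point} (hR : ∀ x, ∃ k : ℤ, IsOfFinAddOrder (x - k • R))
    {Q₁ : APoint D.H} (hQ₁ : φH D Q₁ = Point.map (W' := curveA.twoIsogenyCodomain)
      (D.embK n (Nat.mem_divisors_self n hsq.ne_zero)) (ΘE hsq.ne_zero R))
    (hQ2 : ¬ ∃ y : APoint D.H, IsOfFinAddOrder (Q₁ - (2 : ℤ) • y))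
    (g : D.H ≃ₐ[ℚ] D.H) (hgK : g (D.sqrtNeg n) = D.sqrtNeg n)
    (hmove0 : D.galPt g (D.P n) - D.P n ≠ 0) (hmove1 : D.galPt g (D.P n) - D.P n ≠ tauOne) :
    ∀ L : ℤ, IsScriptL n L → (2 : ℤ) ∣ L ∧ ¬ (4 : ℤ) ∣ L := by
  haveI := isElliptic_congruentNumberCurve hsq.ne_zero
  have hn1 : 1 < n := by rcases h8 with h | h <;> omega
  intro L hL
  exact ⟨two_dvd_scriptL_of_half_not_twoDivisible hGZK hsq hr D h35 hLs hn1 hR hQ₁ hQ2 L hL,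
    not_four_dvd_of_galPt_genusPoint_sub_ne hGZK hsq h8 hr D h35 hLs h318 g hgK hmove0 hmove1 L hL⟩

end EnSide

end Summit.BirchSwinnertonDyer.PrintCf2.LevelTwoGenusQuotient

end
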